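import Literature.Geometry.Lorentzian.IsometryProofs
import HarnessLib

/-!
# Fields of bilinear forms on a vector space: sections versus plain functions

A short support file (topic `Geometry/Manifold`; everything PROVED). On a normed space `F` viewed as
a manifold modelled on itself, the tangent bundle — hence the bundle `Hom(TF, Hom(TF, ℝ))` of
bilinear forms on its tangent spaces — is canonically trivial: the trivializations of `TF` are the
identity (`TangentBundle.symmL_model_space`). Consequently a map `q ↦ (b q, s q)` from any manifold
`Q` into that bundle (`s q` a bilinear form on `T_{b q} F = F`) is `C^k` at `q₀` iff the base map
`b` and the plain function `q ↦ s q : Q → (F →L F →L ℝ)` are: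

* `contMDiffAt_bilinSection_model_iff` (from the general criterion `contMDiffAt_bilin_iff` of
  `IsometryProofs.lean`), `contMDiffOn_bilinSection_model_iff`, `contMDiff_bilinSection_model_iff`.

This is the dictionary between "smooth family of data on `ℝ³`" in the bundle sense
(`InitialDataSet.IsSmoothDataFamily`) and in the sense of smooth matrix-valued functions.

## References

* B. O'Neill, *Semi-Riemannian geometry* (1983), Ch. 3, Def. 3.9 (fields of bilinear forms). [ONeill1983]
-/

noncomputable section

open Bundle Set Function
open scoped Manifold ContDiff Topology

namespace Literature.Geometry.Manifold

open Literature.Geometry.Lorentzian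

variable {EQ : Type*} [NormedAddCommGroup EQ] [NormedSpace ℝ EQ] {HQ : Type*} [TopologicalSpace HQ]
  {IQ : ModelWithCorners ℝ EQ HQ} {Q : Type*} [TopologicalSpace Q] [ChartedSpace HQ Q]
  {F : Type*} [NormedAddCommGroup F] [NormedSpace ℝ F] {k : ℕ∞ω}

/-- **Sections of the bundle of bilinear forms on a vector space are plain functions**: a map
`q ↦ (b q, s q)` into `Hom(TF, Hom(TF, ℝ))` over the normed space `F` is `C^k` at `q₀` iff `b` is
`C^k` at `q₀` and `q ↦ s q` is `C^k` at `q₀` as a map into the normed space `F →L F →L ℝ` (the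
trivializations of `TF` are the identity). [cite: ONeill1983, Ch. 3, Def. 3.9] -/
theorem contMDiffAt_bilinSection_model_iff {b : Q → F} {s : Q → F →L[ℝ] F →L[ℝ] ℝ} {q₀ : Q} :
    ContMDiffAt IQ (𝓘(ℝ, F).prod 𝓘(ℝ, F →L[ℝ] F →L[ℝ] ℝ)) k
        (fun q ↦ TotalSpace.mk' (F →L[ℝ] F →L[ℝ] ℝ)
          (E := fun z : F ↦ TangentSpace 𝓘(ℝ, F) z →L[ℝ] TangentSpace 𝓘(ℝ, F) z →L[ℝ] ℝ) (b q)
          (show TangentSpace 𝓘(ℝ, F) (b q) →L[ℝ] TangentSpace 𝓘(ℝ, F) (b q) →L[ℝ] ℝ from s q)) q₀ ↔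
      ContMDiffAt IQ 𝓘(ℝ, F) k b q₀ ∧ ContMDiffAt IQ 𝓘(ℝ, F →L[ℝ] F →L[ℝ] ℝ) k s q₀ := by
  rw [contMDiffAt_bilin_iff]
  refine and_congr_right fun _ ↦ ?_
  have heq : (fun q ↦ (ContinuousLinearMap.precomp ℝ
      ((trivializationAt F (TangentSpace 𝓘(ℝ, F) : F → Type _) (b q₀)).symmL ℝ (b q))).comp
        ((show TangentSpace 𝓘(ℝ, F) (b q) →L[ℝ] TangentSpace 𝓘(ℝ, F) (b q) →L[ℝ] ℝ from s q).comp
          ((trivializationAt F (TangentSpace 𝓘(ℝ, F) : F → Type _) (b q₀)).symmL ℝ (b q)))) = s := by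
    funext q
    ext v w
    simp only [TangentBundle.symmL_model_space, ContinuousLinearMap.coe_comp, comp_apply,
      ContinuousLinearMap.precomp_apply]
    rfl
  rw [heq]

/-- The same criterion on an OPEN set. [cite: ONeill1983, Ch. 3, Def. 3.9] -/
theorem contMDiffOn_bilinSection_model_iff {b : Q → F} {s : Q → F →L[ℝ] F →L[ℝ] ℝ} {W : Set Q}
    (hW : IsOpen W) :
    ContMDiffOn IQ (𝓘(ℝ, F).prod 𝓘(ℝ, F →L[ℝ] F →L[ℝ] ℝ)) k
        (fun q ↦ TotalSpace.mk' (F →L[ℝ] F →L[ℝ] ℝ)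
          (E := fun z : F ↦ TangentSpace 𝓘(ℝ, F) z →L[ℝ] TangentSpace 𝓘(ℝ, F) z →L[ℝ] ℝ) (b q)
          (show TangentSpace 𝓘(ℝ, F) (b q) →L[ℝ] TangentSpace 𝓘(ℝ, F) (b q) →L[ℝ] ℝ from s q)) W ↔
      ContMDiffOn IQ 𝓘(ℝ, F) k b W ∧ ContMDiffOn IQ 𝓘(ℝ, F →L[ℝ] F →L[ℝ] ℝ) k s W := by
  constructor
  · intro h
    refine ⟨fun q hq ↦ ?_, fun q hq ↦ ?_⟩
    · exact (contMDiffAt_bilinSection_model_iff.1 ((h q hq).contMDiffAt (hW.mem_nhds hq))).1.contMDiffWithinAt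
    · exact (contMDiffAt_bilinSection_model_iff.1 ((h q hq).contMDiffAt (hW.mem_nhds hq))).2.contMDiffWithinAt
  · rintro ⟨hb, hs⟩ q hq
    exact (contMDiffAt_bilinSection_model_iff.2 ⟨(hb q hq).contMDiffAt (hW.mem_nhds hq),
      (hs q hq).contMDiffAt (hW.mem_nhds hq)⟩).contMDiffWithinAt

/-- The global version. [cite: ONeill1983, Ch. 3, Def. 3.9] -/
theorem contMDiff_bilinSection_model_iff {b : Q → F} {s : Q → F →L[ℝ] F →L[ℝ] ℝ} :
    ContMDiff IQ (𝓘(ℝ, F).prod 𝓘(ℝ, F →L[ℝ] F →L[ℝ] ℝ)) k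
        (fun q ↦ TotalSpace.mk' (F →L[ℝ] F →L[ℝ] ℝ)
          (E := fun z : F ↦ TangentSpace 𝓘(ℝ, F) z →L[ℝ] TangentSpace 𝓘(ℝ, F) z →L[ℝ] ℝ) (b q)
          (show TangentSpace 𝓘(ℝ, F) (b q) →L[ℝ] TangentSpace 𝓘(ℝ, F) (b q) →L[ℝ] ℝ from s q)) ↔
      ContMDiff IQ 𝓘(ℝ, F) k b ∧ ContMDiff IQ 𝓘(ℝ, F →L[ℝ] F →L[ℝ] ℝ) k s :=
  ⟨fun h ↦ ⟨fun q ↦ (contMDiffAt_bilinSection_model_iff.1 (h q)).1,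
      fun q ↦ (contMDiffAt_bilinSection_model_iff.1 (h q)).2⟩,
    fun h q ↦ contMDiffAt_bilinSection_model_iff.2 ⟨h.1 q, h.2 q⟩⟩

end Literature.Geometry.Manifold

end
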